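import Summits.RiemannHypothesis.RiemannHypothesis.Theorems.IntegerScrewScrewPolyFloorLandauWindowSharp
import Summits.RiemannHypothesis.RiemannHypothesis.Theorems.IntegerScrewScrewPolyFloorLandauAbel
import Summits.RiemannHypothesis.RiemannHypothesis.Theorems.IntegerScrewScrewPolyFloorLandauTailBlocks
import Literature.NumberTheory.LFunctions.KadiriFarZeroTail
import HarnessLib

/-!
# Route IntegerScrew — the tail of the zero expansion above height `T₀`, integral form

Helper file for crux `IntegerScrew.ScrewPolyFloor` (stmt-RiemannHypothesis-15757): the RH-free
lower bound for a finite piece `T₀ < |Im ρ| ≤ U` of the tail of the unconditional zero expansion of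
the screw form (`hasSum_screwForm`), by Abel summation in integral form
(`abel_window_lower_bound`) against the sharp window positivity (`pairing_window_positive_sharp`):

  `Re ∑_{T₀<|γ|≤U} m(ρ)(−Π_ρ)/(ρ−½)² ≥ [(a/π)(1/T₀ − 1/U) − 2C M²√M (2log²T₀ + log 3M + 16)/T₀²
      − 6 M² B(0,T₀)/T₀] ∑ y_m²`,

`a = log(T₀/2π) − log M − 1`, `Π_ρ = P_y(ρ−½)P_y(½−ρ)`, `B = KadiriTail.tailBound`
(`tail_window_lower`). Ingredients: `−1/s² = 1/γ² − (1/s² + 1/γ²)` with `|1/s² + 1/γ²| ≤ 2/|γ|³`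
(`norm_inv_sq_add_inv_sq_le`), `|Π_ρ| ≤ M² ∑y²` (`norm_pairing_le`), the far-zero sum
`∑_{|γ|>T₀} m(ρ)/γ² ≤ 3B(0,T₀)` (`KadiriTail.sum_far_le`), and for the main weights `1/γ²` the
Abel lemma with the polynomial minorant `lb(u) = (a/π)(u − T₀) − 2C M²√M(2 log²T₀ + log 3M + 8u/T₀)`
of the window bound (`log u ≤ log²u`, `log²u ≤ 2log²T₀ + 8u/T₀`), whose integral against `2u⁻³` is
elementary. No blocking, hence no loss in the admissible height: downstream `T₀ = M³`.
-/

noncomputable section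

open Complex Finset MeasureTheory Set intervalIntegral
open scoped Real

-- the layout-mandated namespace repeats the summit name
set_option linter.dupNamespace false

namespace Summit.RiemannHypothesis.RiemannHypothesis.Theorems.IntegerScrewLandau

open Literature.NumberTheory.LFunctions

/-! ### Elementary pieces -/

/-- `2/a − 2/U = ∫_a^U 2u⁻² du` for `0 < a ≤ U`. [folklore] -/
theorem two_div_sub_two_div_eq_integral {a U : ℝ} (ha : 0 < a) (haU : a ≤ U) :
    2 / a - 2 / U = ∫ u in a..U, 2 / u ^ 2 := by
  have hderiv : ∀ u ∈ uIcc a U, HasDerivAt (fun u : ℝ ↦ -(2 * u⁻¹)) (2 / u ^ 2) u := by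
    intro u hu
    rw [uIcc_of_le haU, Set.mem_Icc] at hu
    have hu0 : u ≠ 0 := by intro h; rw [h] at hu; linarith [hu.1]
    have h := ((hasDerivAt_inv hu0).const_mul 2).neg
    refine h.congr_deriv ?_
    field_simp
  have hcont : ContinuousOn (fun u : ℝ ↦ 2 / u ^ 2) (uIcc a U) := by
    refine ContinuousOn.div continuousOn_const (by fun_prop) fun u hu ↦ ?_
    rw [uIcc_of_le haU, Set.mem_Icc] at hu
    exact pow_ne_zero 2 (by intro h; rw [h] at hu; linarith [hu.1])
  rw [integral_eq_sub_of_hasDerivAt hderiv (hcont.intervalIntegrable)]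
  have hU0 : U ≠ 0 := by intro h; rw [h] at haU; linarith
  field_simp
  ring

/-- `log² u ≤ 2 log²T₀ + 8u/T₀` for `0 < T₀ ≤ u` (`log(u/T₀) ≤ 2√(u/T₀)`). [folklore] -/
theorem log_sq_le {T₀ u : ℝ} (h0 : 0 < T₀) (h1 : 1 ≤ T₀) (hu : T₀ ≤ u) :
    Real.log u ^ 2 ≤ 2 * Real.log T₀ ^ 2 + 8 * u / T₀ := by
  have hu0 : 0 < u := lt_of_lt_of_le h0 hu
  set v : ℝ := u / T₀ with hv
  have hv1 : 1 ≤ v := by rw [hv, le_div_iff₀ h0]; linarith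
  have hv0 : 0 < v := by linarith
  have hsq : 0 < Real.sqrt v := Real.sqrt_pos.2 hv0
  have hlogv : Real.log v ≤ 2 * Real.sqrt v := by
    have h := Real.log_le_sub_one_of_pos hsq
    rw [Real.log_sqrt hv0.le] at h
    linarith
  have hlogu : Real.log u = Real.log T₀ + Real.log v := by
    rw [hv, Real.log_div hu0.ne' h0.ne']; ring
  have hlT : 0 ≤ Real.log T₀ := Real.log_nonneg h1
  have hlv : 0 ≤ Real.log v := Real.log_nonneg hv1
  have hsq2 : Real.sqrt v ^ 2 = v := Real.sq_sqrt hv0.le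
  calc Real.log u ^ 2 = (Real.log T₀ + Real.log v) ^ 2 := by rw [hlogu]
    _ ≤ 2 * Real.log T₀ ^ 2 + 2 * Real.log v ^ 2 := by nlinarith [sq_nonneg (Real.log T₀ - Real.log v)]
    _ ≤ 2 * Real.log T₀ ^ 2 + 2 * (2 * Real.sqrt v) ^ 2 := by
        gcongr
    _ = 2 * Real.log T₀ ^ 2 + 8 * u / T₀ := by rw [mul_pow, hsq2, hv]; ring

/-- A sum over a window of zeros, as a `Finset` of the subtype or of `ℂ`. [folklore] -/
theorem sum_sdiff_zerosUpTo_eq_sum_sdiff_weilZeroIndex {V W : ℝ} (hVW : V ≤ W) (g : ℂ → ℂ) :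
    ∑ ρ ∈ SchoenfeldBound.zerosUpTo W \ SchoenfeldBound.zerosUpTo V, g (ρ : ℂ) =
      ∑ z ∈ (weilZeroIndex_finite W).toFinset \ (weilZeroIndex_finite V).toFinset, g z := by
  rw [Finset.sum_sdiff_eq_sub (SchoenfeldBound.zerosUpTo_subset hVW),
    Finset.sum_sdiff_eq_sub (weilZeroIndex_toFinset_mono hVW),
    sum_zerosUpTo_eq_sum_weilZeroIndex, sum_zerosUpTo_eq_sum_weilZeroIndex]

/-- Real-valued version. [folklore] -/
theorem sum_sdiff_zerosUpTo_eq_sum_sdiff_weilZeroIndex_real {V W : ℝ} (hVW : V ≤ W) (g : ℂ → ℝ) :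
    ∑ ρ ∈ SchoenfeldBound.zerosUpTo W \ SchoenfeldBound.zerosUpTo V, g (ρ : ℂ) =
      ∑ z ∈ (weilZeroIndex_finite W).toFinset \ (weilZeroIndex_finite V).toFinset, g z := by
  have h := sum_sdiff_zerosUpTo_eq_sum_sdiff_weilZeroIndex hVW (fun z ↦ (g z : ℂ))
  exact_mod_cast h

/-- **The far-zero sum over a window** (`KadiriTail.sum_far_le` at `t = 0`): for `4 ≤ T₀ ≤ U`,
`∑_{T₀<|γ|≤U} m(ρ)/γ² ≤ 3 B(0, T₀)`. [folklore] -/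
theorem sum_window_order_div_sq_le {T₀ U : ℝ} (hT₀ : 4 ≤ T₀) (hU : T₀ ≤ U) :
    ∑ z ∈ (weilZeroIndex_finite U).toFinset \ (weilZeroIndex_finite T₀).toFinset,
        (riemannZetaZeroOrder z : ℝ) / z.im ^ 2 ≤ 3 * KadiriTail.tailBound 0 T₀ := by
  classical
  have h := KadiriTail.sum_far_le (t := 0) le_rfl hT₀
    (SchoenfeldBound.zerosUpTo U \ SchoenfeldBound.zerosUpTo T₀)
  rw [← sum_sdiff_zerosUpTo_eq_sum_sdiff_weilZeroIndex_real hU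
    (fun z ↦ (riemannZetaZeroOrder z : ℝ) / z.im ^ 2)]
  refine le_trans (le_of_eq ?_) h
  refine Finset.sum_congr rfl fun ρ hρ ↦ ?_
  rw [Finset.mem_sdiff, SchoenfeldBound.mem_zerosUpTo, SchoenfeldBound.mem_zerosUpTo, not_le] at hρ
  rw [sub_zero, if_pos hρ.2.le]

/-! ### The tail over a finite window -/

set_option maxHeartbeats 1600000 in
/-- **The tail above `T₀`, finite form, without RH.** Let `C, T*` be constants for which the sharp
window positivity `pairing_window_positive_sharp` holds. For `M ≥ 1`, real `y`,
`max(T*, 4) ≤ T₀ ≤ U` and `a = log(T₀/2π) − log M − 1` (of either sign), the zeros with `T₀ < |Im ρ| ≤ U`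
contribute to the expansion of the screw form at least
`[(a/π)(1/T₀ − 1/U) − 2C M²√M(2log²T₀ + log 3M + 16)/T₀² − 6M² B(0,T₀)/T₀] ∑ y_m²`
(`B = KadiriTail.tailBound`). [folklore] -/
theorem tail_window_lower :
    ∀ {CP TP : ℝ}, 0 ≤ CP →
    (∀ (M : ℕ), 1 ≤ M → ∀ (y : ℕ → ℝ) (T₁ T₂ : ℝ), TP ≤ T₁ → T₁ ≤ T₂ →
      ((T₂ - T₁) / π * (Real.log (T₁ / (2 * π)) - Real.log M - 1) -
          CP * (Real.log T₂ + (M : ℝ) ^ 2 * Real.sqrt M * (Real.log T₂ ^ 2 + Real.log (3 * M)))) *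
          ∑ m ∈ Icc 1 M, y m ^ 2 ≤
      ((∑ ρ ∈ (weilZeroIndex_finite T₂).toFinset, (riemannZetaZeroOrder ρ : ℂ) *
          ((∑ m ∈ Icc 1 M, (y m : ℂ) * (m : ℂ) ^ (ρ - 1 / 2)) *
            (∑ m ∈ Icc 1 M, (y m : ℂ) * (m : ℂ) ^ (-(ρ - 1 / 2))))) -
        ∑ ρ ∈ (weilZeroIndex_finite T₁).toFinset, (riemannZetaZeroOrder ρ : ℂ) *
          ((∑ m ∈ Icc 1 M, (y m : ℂ) * (m : ℂ) ^ (ρ - 1 / 2)) *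
            (∑ m ∈ Icc 1 M, (y m : ℂ) * (m : ℂ) ^ (-(ρ - 1 / 2))))).re) →
    ∀ {M : ℕ}, 1 ≤ M → ∀ (y : ℕ → ℝ) {T₀ U : ℝ}, TP ≤ T₀ → 4 ≤ T₀ → T₀ ≤ U →
    ((Real.log (T₀ / (2 * π)) - Real.log M - 1) / π * (1 / T₀ - 1 / U) -
        2 * CP * (M : ℝ) ^ 2 * Real.sqrt M *
          (2 * Real.log T₀ ^ 2 + Real.log (3 * M) + 16) / T₀ ^ 2 -
        6 * (M : ℝ) ^ 2 * KadiriTail.tailBound 0 T₀ / T₀) * ∑ m ∈ Icc 1 M, y m ^ 2 ≤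
      (∑ ρ ∈ SchoenfeldBound.zerosUpTo U \ SchoenfeldBound.zerosUpTo T₀,
        (riemannZetaZeroOrder (ρ : ℂ) : ℂ) *
          (-((∑ m ∈ Icc 1 M, ((y m : ℝ) : ℂ) * (m : ℂ) ^ ((ρ : ℂ) - 1 / 2)) *
              ∑ m ∈ Icc 1 M, ((y m : ℝ) : ℂ) * (m : ℂ) ^ (-((ρ : ℂ) - 1 / 2))) /
            ((ρ : ℂ) - 1 / 2) ^ 2)).re := by
  intro CP TP hCP hpos M hM y T₀ U hT₀P hT₀4 hU
  classical
  have hT₀0 : 0 < T₀ := by linarith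
  have hT₀1 : 1 ≤ T₀ := by linarith
  have hU0 : 0 < U := by linarith
  have hM1 : (1 : ℝ) ≤ M := by exact_mod_cast hM
  set S : ℝ := ∑ m ∈ Icc 1 M, y m ^ 2 with hS
  have hS0 : 0 ≤ S := Finset.sum_nonneg fun _ _ ↦ sq_nonneg _
  set a : ℝ := Real.log (T₀ / (2 * π)) - Real.log M - 1 with hadef
  set ℓ₀ : ℝ := Real.log T₀ with hℓ₀
  set lam : ℝ := Real.log (3 * M) with hlam
  have hlam0 : 0 ≤ lam := Real.log_nonneg (by linarith)
  set E : ℝ := (M : ℝ) ^ 2 * Real.sqrt M with hE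
  have hsqM1 : 1 ≤ Real.sqrt M := by
    rw [show (1 : ℝ) = Real.sqrt 1 by simp]; exact Real.sqrt_le_sqrt hM1
  have hE1 : 1 ≤ E := by
    rw [hE]; nlinarith [one_le_pow₀ (n := 2) hM1]
  have hE0 : 0 ≤ E := by linarith
  -- the summands
  set Pf : ℂ → ℂ := fun z ↦ (∑ m ∈ Icc 1 M, ((y m : ℝ) : ℂ) * (m : ℂ) ^ (z - 1 / 2)) *
    ∑ m ∈ Icc 1 M, ((y m : ℝ) : ℂ) * (m : ℂ) ^ (-(z - 1 / 2)) with hPf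
  set mf : ℂ → ℂ := fun z ↦ (riemannZetaZeroOrder z : ℂ) with hmf
  set f : ℂ → ℂ := fun z ↦ mf z * Pf z with hf
  set Bc := (weilZeroIndex_finite U).toFinset \ (weilZeroIndex_finite T₀).toFinset with hBc
  -- (0) the window as a `Finset` of `ℂ`
  rw [sum_sdiff_zerosUpTo_eq_sum_sdiff_weilZeroIndex hU (fun z ↦ mf z * (-(Pf z) / (z - 1 / 2) ^ 2))]
  -- facts about the zeros of the window
  have hmem : ∀ z ∈ Bc, T₀ < |z.im| ∧ |z.im| ≤ U ∧ |(z - 1 / 2).re| ≤ 1 / 2 ∧ (z - 1 / 2).im = z.im ∧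
      0 ≤ (riemannZetaZeroOrder z : ℝ) := by
    intro z hz
    obtain ⟨h1, h2⟩ := abs_im_of_mem_sdiff hz
    rw [hBc, Finset.mem_sdiff, mem_weilZeroIndex_toFinset] at hz
    obtain ⟨⟨h0, hr0, hr1, -, -⟩, -⟩ := hz
    refine ⟨h1, h2, ?_, by simp, ?_⟩
    · rw [abs_le]; simp only [sub_re, one_div]; norm_num; exact ⟨by linarith, by linarith⟩
    · exact_mod_cast riemannZetaZeroOrder_nonneg (ne_one_of_riemannZeta_eq_zero h0)
  -- (1) the weights: `−1/s² = 1/γ² − (1/s² + 1/γ²)`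
  have hsplit : ∀ z ∈ Bc, mf z * (-(Pf z) / (z - 1 / 2) ^ 2) =
      f z * ((((z.im ^ 2)⁻¹ : ℝ)) : ℂ) - f z * (((z - 1 / 2) ^ 2)⁻¹ + ((((z - 1 / 2).im ^ 2 : ℝ)) : ℂ)⁻¹) := by
    intro z hz
    obtain ⟨h1, -, -, him, -⟩ := hmem z hz
    rw [him, Complex.ofReal_inv]
    simp only [hf]
    ring
  rw [Finset.sum_congr rfl hsplit, Finset.sum_sub_distrib, Complex.sub_re]
  -- (2) the correction `∑ |f| · 2/|γ|³ ≤ 6 M² B S/T₀`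
  have hcorr : (∑ z ∈ Bc, f z * (((z - 1 / 2) ^ 2)⁻¹ + ((((z - 1 / 2).im ^ 2 : ℝ)) : ℂ)⁻¹)).re ≤
      6 * (M : ℝ) ^ 2 * KadiriTail.tailBound 0 T₀ / T₀ * S := by
    refine (Complex.re_le_norm _).trans ((norm_sum_le _ _).trans ?_)
    have hterm : ∀ z ∈ Bc, ‖f z * (((z - 1 / 2) ^ 2)⁻¹ + ((((z - 1 / 2).im ^ 2 : ℝ)) : ℂ)⁻¹)‖ ≤
        (2 * (M : ℝ) ^ 2 * S / T₀) * ((riemannZetaZeroOrder z : ℝ) / z.im ^ 2) := by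
      intro z hz
      obtain ⟨h1, -, hre, him, hm0⟩ := hmem z hz
      have hγ1 : 1 ≤ |(z - 1 / 2).im| := by rw [him]; linarith
      have hw := norm_inv_sq_add_inv_sq_le hre hγ1
      rw [him] at hw
      have hP : ‖Pf z‖ ≤ (M : ℝ) ^ 2 * S := by simp only [hPf, hS]; exact norm_pairing_le M y hre
      have hfz : ‖f z‖ ≤ (riemannZetaZeroOrder z : ℝ) * ((M : ℝ) ^ 2 * S) := by
        simp only [hf, hmf]
        rw [norm_mul, Complex.norm_intCast, abs_of_nonneg hm0]
        exact mul_le_mul_of_nonneg_left hP hm0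
      have hγ0 : 0 < |z.im| := by linarith
      have hcube : 2 / |z.im| ^ 3 ≤ 2 / T₀ * (1 / z.im ^ 2) := by
        rw [← sq_abs z.im, pow_succ, div_mul_div_comm, mul_one, mul_comm (|z.im| ^ 2)]
        exact div_le_div_of_nonneg_left (by norm_num) (by positivity)
          (mul_le_mul_of_nonneg_right h1.le (sq_nonneg _))
      rw [norm_mul, him]
      calc ‖f z‖ * ‖((z - 1 / 2) ^ 2)⁻¹ + ((((z.im ^ 2 : ℝ)) : ℂ))⁻¹‖
          ≤ ((riemannZetaZeroOrder z : ℝ) * ((M : ℝ) ^ 2 * S)) * (2 / T₀ * (1 / z.im ^ 2)) :=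
            mul_le_mul hfz (hw.trans hcube) (norm_nonneg _) (by positivity)
        _ = (2 * (M : ℝ) ^ 2 * S / T₀) * ((riemannZetaZeroOrder z : ℝ) / z.im ^ 2) := by ring
    refine (Finset.sum_le_sum hterm).trans ?_
    rw [← Finset.mul_sum]
    have hfar := sum_window_order_div_sq_le hT₀4 hU
    calc 2 * (M : ℝ) ^ 2 * S / T₀ * ∑ z ∈ Bc, (riemannZetaZeroOrder z : ℝ) / z.im ^ 2
        ≤ 2 * (M : ℝ) ^ 2 * S / T₀ * (3 * KadiriTail.tailBound 0 T₀) :=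
          mul_le_mul_of_nonneg_left hfar (by positivity)
      _ = 6 * (M : ℝ) ^ 2 * KadiriTail.tailBound 0 T₀ / T₀ * S := by ring
  -- (3) the main weights `1/γ²`: Abel summation against the polynomial minorant
  set lb : ℝ → ℝ := fun u ↦ (a / π * (u - T₀) - 2 * CP * E * (2 * ℓ₀ ^ 2 + lam + 8 * u / T₀)) * S
    with hlb
  have hlbcont : ContinuousOn lb (Icc T₀ U) := by
    simp only [hlb]
    fun_prop
  have hle : ∀ u ∈ Icc T₀ U, lb u ≤
      (∑ z ∈ (weilZeroIndex_finite u).toFinset \ (weilZeroIndex_finite T₀).toFinset, f z).re := by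
    intro u hu
    rw [Set.mem_Icc] at hu
    have hwin := hpos M hM y T₀ u hT₀P hu.1
    rw [← Finset.sum_sdiff_eq_sub (weilZeroIndex_toFinset_mono hu.1)] at hwin
    refine le_trans ?_ hwin
    refine mul_le_mul_of_nonneg_right ?_ hS0
    -- `log u + E(log²u + λ) ≤ 2E(2ℓ₀² + λ + 8u/T₀)`
    have hu0 : 0 < u := by linarith
    have hlogu1 : 1 ≤ Real.log u := by
      rw [Real.le_log_iff_exp_le hu0]
      have := Real.exp_one_lt_d9
      linarith
    have hlogu0 : 0 ≤ Real.log u := by linarith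
    have hlog_sq : Real.log u ≤ Real.log u ^ 2 := by nlinarith
    have hsq := log_sq_le hT₀0 hT₀1 hu.1
    have hkey : Real.log u + E * (Real.log u ^ 2 + lam) ≤ 2 * E * (2 * ℓ₀ ^ 2 + lam + 8 * u / T₀) := by
      have h1 : Real.log u ≤ E * Real.log u ^ 2 := by
        calc Real.log u ≤ Real.log u ^ 2 := hlog_sq
          _ = 1 * Real.log u ^ 2 := (one_mul _).symm
          _ ≤ E * Real.log u ^ 2 := mul_le_mul_of_nonneg_right hE1 (sq_nonneg _)
      have h2 : E * Real.log u ^ 2 ≤ E * (2 * ℓ₀ ^ 2 + 8 * u / T₀) := mul_le_mul_of_nonneg_left hsq hE0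
      have h3 : 0 ≤ E * lam := by positivity
      nlinarith [h1, h2, h3]
    have := mul_le_mul_of_nonneg_left hkey hCP
    rw [← hadef, ← hE, ← hlam]
    have e1 : (u - T₀) / π * a = a / π * (u - T₀) := by ring
    have e2 : CP * (2 * E * (2 * ℓ₀ ^ 2 + lam + 8 * u / T₀)) =
        2 * CP * E * (2 * ℓ₀ ^ 2 + lam + 8 * u / T₀) := by ring
    linarith [this, e1, e2]
  have habel := abel_window_lower_bound T₀ U hT₀0 hU f lb hlbcont hle
  -- the boundary term `≥ lb(U)/U²`
  have hbdry : lb U / U ^ 2 ≤ (∑ z ∈ Bc, f z).re / U ^ 2 :=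
    div_le_div_of_nonneg_right (hle U ⟨hU, le_rfl⟩) (sq_nonneg _)
  -- the integral, computed
  set α : ℝ := (a / π - 16 * CP * E / T₀) * S with hα
  set β : ℝ := (a * T₀ / π + 2 * CP * E * (2 * ℓ₀ ^ 2 + lam)) * S with hβ
  have hlb_eq : ∀ u, lb u = α * u - β := by
    intro u; simp only [hlb, hα, hβ]; field_simp; ring
  have hint : ∫ u in T₀..U, 2 / u ^ 3 * lb u = α * (2 / T₀ - 2 / U) - β * ((T₀ ^ 2)⁻¹ - (U ^ 2)⁻¹) := by
    have hcongr : ∫ u in T₀..U, 2 / u ^ 3 * lb u = ∫ u in T₀..U, (α * (2 / u ^ 2) - β * (2 / u ^ 3)) := by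
      refine integral_congr fun u hu ↦ ?_
      rw [uIcc_of_le hU, Set.mem_Icc] at hu
      have hu0 : u ≠ 0 := by intro h; rw [h] at hu; linarith [hu.1]
      rw [hlb_eq u]
      field_simp
    have hc2 : ContinuousOn (fun u : ℝ ↦ 2 / u ^ 2) (uIcc T₀ U) := by
      refine ContinuousOn.div continuousOn_const (by fun_prop) fun u hu ↦ ?_
      rw [uIcc_of_le hU, Set.mem_Icc] at hu
      exact pow_ne_zero 2 (by intro h; rw [h] at hu; linarith [hu.1])
    have hc3 : ContinuousOn (fun u : ℝ ↦ 2 / u ^ 3) (uIcc T₀ U) := by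
      refine ContinuousOn.div continuousOn_const (by fun_prop) fun u hu ↦ ?_
      rw [uIcc_of_le hU, Set.mem_Icc] at hu
      exact pow_ne_zero 3 (by intro h; rw [h] at hu; linarith [hu.1])
    rw [hcongr, intervalIntegral.integral_sub ((hc2.intervalIntegrable).const_mul α)
      ((hc3.intervalIntegrable).const_mul β), intervalIntegral.integral_const_mul,
      intervalIntegral.integral_const_mul, ← two_div_sub_two_div_eq_integral hT₀0 hU,
      ← inv_sq_sub_inv_sq_eq_integral hT₀0 hU]
  -- (4) assemble
  have hmain : (a / π * (1 / T₀ - 1 / U) - 2 * CP * E * (2 * ℓ₀ ^ 2 + lam + 16) / T₀ ^ 2) * S ≤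
      (∑ z ∈ Bc, f z * ((((z.im ^ 2)⁻¹ : ℝ)) : ℂ)).re := by
    refine le_trans ?_ habel
    rw [hint]
    refine le_trans ?_ (add_le_add hbdry le_rfl)
    rw [hlb_eq U]
    -- `lb(U)/U² + α(2/T₀ − 2/U) − β(1/T₀² − 1/U²) = 2α/T₀ − α/U − β/T₀²`
    have e1 : (α * U - β) / U ^ 2 + (α * (2 / T₀ - 2 / U) - β * ((T₀ ^ 2)⁻¹ - (U ^ 2)⁻¹)) =
        2 * α / T₀ - α / U - β / T₀ ^ 2 := by
      field_simp
      ring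
    rw [e1]
    have hαle : α ≤ a / π * S := by
      rw [hα]
      have : 0 ≤ 16 * CP * E / T₀ * S := by positivity
      nlinarith
    have hαU : α / U ≤ a / π * S / U := div_le_div_of_nonneg_right hαle hU0.le
    have e2 : (a / π * (1 / T₀ - 1 / U) - 2 * CP * E * (2 * ℓ₀ ^ 2 + lam + 16) / T₀ ^ 2) * S =
        2 * α / T₀ - a / π * S / U - β / T₀ ^ 2 := by
      rw [hα, hβ]
      field_simp
      ring
    rw [e2]
    linarith
  have hfinal : ((Real.log (T₀ / (2 * π)) - Real.log M - 1) / π * (1 / T₀ - 1 / U) -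
        2 * CP * (M : ℝ) ^ 2 * Real.sqrt M * (2 * Real.log T₀ ^ 2 + Real.log (3 * M) + 16) / T₀ ^ 2 -
        6 * (M : ℝ) ^ 2 * KadiriTail.tailBound 0 T₀ / T₀) * S =
      (a / π * (1 / T₀ - 1 / U) - 2 * CP * E * (2 * ℓ₀ ^ 2 + lam + 16) / T₀ ^ 2) * S -
        6 * (M : ℝ) ^ 2 * KadiriTail.tailBound 0 T₀ / T₀ * S := by
    simp only [hadef, hE, hℓ₀, hlam]; ring
  rw [hfinal]
  linarith [hmain, hcorr]

end Summit.RiemannHypothesis.RiemannHypothesis.Theorems.IntegerScrewLandau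

end
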